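import Literature.NumberTheory.EllipticCurves.NeronComponentIndexTypeIIIProofs
import Summits.BirchSwinnertonDyer.BirchSwinnertonDyer.Theorems.ManinLocalTwoThreeTameCellLocalTwoTorsionHolds
import HarnessLib

/-!
# Kodaira type `III` at `3` on the cell `9 ∥ N`, `ord₃(Δ_min) = 3`: the Tate normal form over `ℤ₃`

Summit `BirchSwinnertonDyer`, route `ManinLocalTwoThree` (cell bsd-f2-manin), crux C3 `ManinPrimeToThreeAtNine`
(stmt-BirchSwinnertonDyer-22968).  Local input for the two `ℚ₃`-line laws of the type-`III` cluster
(`TameThreeCharacter.TameThreeIIIAtMostOneLocalLine` = E-imc-76u and `TameThreeCharacter.TypeThreeSubgroupCharacterUnramified`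
= E-imc-71, typer file `Rank1Residual/ManinAdditive/TypeThreeSubgroupCharacter.lean`), in the architecture of the lead's
E-imc-75 proof (`tameCellAtMostOneLocalTwoTorsionPoint_holds`):

* `kodairaSymbolAt_eq_III_of_conductorExponent_eq_two_of_ordMinimalDiscriminant_eq_three` — Ogg's formula (the tree's
  definition of `f_v`) with `f_v = 2`, `ord_v Δ_min = 3` leaves only `m_v = 2`, i.e. type `III` (any Dedekind base);
* `kodairaSymbolAt_eq_III_of_nine_dvd_conductorNorm`, `kodairaSymbolOfMinimal_padicThree_eq_III` — over `ℚ`: `9 ∥ N_W`,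
  `ord₃ Δ_min = 3` ⟹ Tate's algorithm over `ℤ₃` returns `III` on the minimal model of `W ⊗ ℚ₃`;
* `exists_IIINormalForm_padicInt` — the tree's type-`III` normal form `LocalIndex.exists_smul_of_kodairaSymbolOfMinimal_eq_III`
  over `ℤ₃` in the shape `[3α₁, 3α₂, 3α₃, 3α₄ (unit), 9α₆]`;
* `threeDivision_eval_smul`, `twoDivisionDisc_eval_smul` — covariance of `Ψ₃` (weight 8) and `Ψ₂²` (weight 6) under any change
  of variables over a field;
* `map_b_of_IIINormalForm` — the `b`-invariants of the normal form: `b₂ = 3β`, `b₄ = 3γ`, `b₆ = 9δ`, `b₈ = 9(3ζ − α₄²)`.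

Nothing about BSD or Manin's conjecture is proved. [cite: SilvermanATAEC1994, IV.9.4 (step 4) and Table 4.1]
-/

set_option autoImplicit false
set_option linter.dupNamespace false

noncomputable section

open scoped Classical
open IsLocalRing WeierstrassCurve IsDedekindDomain
open IsDiscreteValuationRing hiding maximalIdeal
open Literature.NumberTheory.DiophantineGeometry Literature.NumberTheory.DiophantineGeometry.TateAlgorithm

namespace Summit.BirchSwinnertonDyer.BirchSwinnertonDyer.Theorems.ManinLocalTwoThree

/-! ### §1 Kodaira type `III` from `f_v = 2`, `ord_v Δ_min = 3` -/

section Local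

variable {A : Type*} [CommRing A] [IsDedekindDomain A] {K : Type*} [Field K] [Algebra A K] [IsFractionRing A K]
  (v : HeightOneSpectrum A) (W : WeierstrassCurve K)

/-- **`f_v = 2` and `ord_v(Δ_min) = 3` force Kodaira type `III`.**  With Ogg's formula `f_v = ord_v(Δ_min) + 1 − m_v` (the tree's
definition of `conductorExponent`) and additivity of the symbol (`f_v ≥ 2`), `m_v = 2` singles out `III` among the additive types
(`m = 1, 2, 3, n + 5, 7, 8, 9`). [cite: SilvermanATAEC1994, IV.9.4 and Table 4.1] -/
theorem kodairaSymbolAt_eq_III_of_conductorExponent_eq_two_of_ordMinimalDiscriminant_eq_three [W.IsElliptic]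
    [PerfectField (IsLocalRing.ResidueField (v.adicCompletionIntegers K))]
    (hf : W.conductorExponent v = 2) (hΔ : W.ordMinimalDiscriminant v = 3) : W.kodairaSymbolAt v = .III := by
  have hadd : (W.kodairaSymbolAt v).IsAdditive :=
    (isAdditive_kodairaSymbolAt_iff_holds v W).mpr ((two_le_conductorExponent_iff_holds v W).mp (by omega))
  have hf' := hf
  unfold WeierstrassCurve.conductorExponent WeierstrassCurve.numComponentsAt at hf'
  rw [hΔ] at hf'
  generalize hT : W.kodairaSymbolAt v = T at hadd hf'
  cases T with
  | I n => exact absurd hadd (KodairaSymbol.not_isAdditive_I n)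
  | II => rw [show KodairaSymbol.numComponents .II = 1 from rfl] at hf'; omega
  | III => rfl
  | IV => rw [show KodairaSymbol.numComponents .IV = 3 from rfl] at hf'; omega
  | Istar n => rw [KodairaSymbol.numComponents_Istar] at hf'; omega
  | IVstar => rw [show KodairaSymbol.numComponents .IVstar = 7 from rfl] at hf'; omega
  | IIIstar => rw [show KodairaSymbol.numComponents .IIIstar = 8 from rfl] at hf'; omega
  | IIstar => rw [show KodairaSymbol.numComponents .IIstar = 9 from rfl] at hf'; omega

end Local

/-- `9 ∥ N_E` means `f₃ = 2` at the place `v` of `ℤ` above `3` (`N_E = ∏ p ^ f_p`, `factorization_conductorNorm_holds`).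
[cite: SilvermanAEC2009, C.16] -/
theorem conductorExponent_eq_two_of_nine_dvd_conductorNorm (W : WeierstrassCurve ℚ) [W.IsElliptic] (v : HeightOneSpectrum ℤ)
    (hv : Rat.HeightOneSpectrum.natGenerator v = 3) (h9 : 3 ^ 2 ∣ W.conductorNorm ℤ) (h27 : ¬ 3 ^ 3 ∣ W.conductorNorm ℤ) :
    W.conductorExponent v = 2 := by
  have hN : W.conductorNorm ℤ ≠ 0 := (conductorNorm_pos_holds W).ne'
  have hfac : (W.conductorNorm ℤ).factorization 3 = W.conductorExponent v := by
    rw [← hv]; exact factorization_conductorNorm_holds W v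
  rw [Nat.prime_three.pow_dvd_iff_le_factorization hN, hfac] at h9 h27
  omega

/-- **`9 ∥ N_E`, `ord₃(Δ_min) = 3` ⟹ Kodaira type `III` at `3`** for an elliptic curve over `ℚ` in a globally minimal equation
(`v` the place of `ℤ` above `3`). [cite: SilvermanATAEC1994, IV.9.4 and Table 4.1] -/
theorem kodairaSymbolAt_eq_III_of_nine_dvd_conductorNorm (W : WeierstrassCurve ℚ) [W.IsElliptic] [W.IsGloballyMinimal]
    (v : HeightOneSpectrum ℤ) (hv : Rat.HeightOneSpectrum.natGenerator v = 3) (h9 : 3 ^ 2 ∣ W.conductorNorm ℤ)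
    (h27 : ¬ 3 ^ 3 ∣ W.conductorNorm ℤ) (hΔ : padicValInt 3 W.minimalDiscriminantInt = 3) : W.kodairaSymbolAt v = .III := by
  have hΔ' : W.ordMinimalDiscriminant v = 3 := by
    rw [W.ordMinimalDiscriminant_eq_padicValInt_natGenerator' v, hv, hΔ]
  exact kodairaSymbolAt_eq_III_of_conductorExponent_eq_two_of_ordMinimalDiscriminant_eq_three v W
    (conductorExponent_eq_two_of_nine_dvd_conductorNorm W v hv h9 h27) hΔ'

/-- The same read over `ℤ₃` (`kodairaSymbolAt_eq_padic`): Tate's algorithm returns `III` on the integral minimal model of `W ⊗ ℚ₃`.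
[cite: SilvermanATAEC1994, IV.9.4 and Table 4.1] -/
theorem kodairaSymbolOfMinimal_padicThree_eq_III (W : WeierstrassCurve ℚ) [W.IsElliptic] [W.IsGloballyMinimal]
    (h9 : 3 ^ 2 ∣ W.conductorNorm ℤ) (h27 : ¬ 3 ^ 3 ∣ W.conductorNorm ℤ) (hΔ : padicValInt 3 W.minimalDiscriminantInt = 3) :
    (((W.baseChange ℚ_[3]).minimal ℤ_[3]).integralModel ℤ_[3]).kodairaSymbolOfMinimal = .III := by
  set v : HeightOneSpectrum ℤ := (Rat.HeightOneSpectrum.primesEquiv (R := ℤ)).symm ⟨3, Nat.prime_three⟩ with hvdef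
  have hv : Rat.HeightOneSpectrum.natGenerator v = 3 :=
    Literature.NumberTheory.EllipticCurves.Rat.natGenerator_primesEquiv_symm ⟨3, Nat.prime_three⟩
  have hK := kodairaSymbolAt_eq_III_of_nine_dvd_conductorNorm W v hv h9 h27 hΔ
  have e : Rat.HeightOneSpectrum.primesEquiv (R := ℤ) v = ⟨3, Nat.prime_three⟩ := Equiv.apply_symm_apply _ _
  have hKp := WeierstrassCurve.kodairaSymbolAt_eq_padic (R := ℤ) v W
  rw [e] at hKp
  change W.kodairaSymbolAt v = (((W.baseChange ℚ_[3]).minimal ℤ_[3]).integralModel ℤ_[3]).kodairaSymbolOfMinimal at hKp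
  rw [hK] at hKp
  exact hKp.symm

/-! ### §2 The type-`III` normal form over `ℤ₃` -/

/-- A non-unit of `ℤ₃` is `3` times a `3`-adic integer. [folklore] -/
theorem padicInt_three_eq_three_mul_of_not_isUnit {x : ℤ_[3]} (hx : ¬ IsUnit x) : ∃ w : ℤ_[3], x = 3 * w := by
  have hm : x ∈ IsLocalRing.maximalIdeal ℤ_[3] := (IsLocalRing.mem_maximalIdeal _).mpr hx
  rw [PadicInt.maximalIdeal_eq_span_p, Ideal.mem_span_singleton'] at hm
  obtain ⟨w, hw⟩ := hm
  exact ⟨w, by rw [← hw]; push_cast; ring⟩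

/-- **The type-`III` normal form over `ℤ₃`.**  If Tate's algorithm returns `III` on `V / ℤ₃`, some change of variables over `ℤ₃`
brings `V` to `[3α₁, 3α₂, 3α₃, 3α₄, 9α₆]` with `α₄ ∈ ℤ₃ˣ` (the tree's `LocalIndex.exists_smul_of_kodairaSymbolOfMinimal_eq_III`:
`a₁, a₂, a₃, a₄ ∈ 𝔪`, `a₄ ∉ 𝔪²`, `a₆ ∈ 𝔪²`). [cite: SilvermanATAEC1994, IV.9.4 Step 4] -/
theorem exists_IIINormalForm_padicInt (V : WeierstrassCurve ℤ_[3]) (hV : V.kodairaSymbolOfMinimal = .III) :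
    ∃ (D : VariableChange ℤ_[3]) (α₁ α₂ α₃ α₄ α₆ : ℤ_[3]),
      (D • V).a₁ = 3 * α₁ ∧ (D • V).a₂ = 3 * α₂ ∧ (D • V).a₃ = 3 * α₃ ∧ (D • V).a₄ = 3 * α₄ ∧ IsUnit α₄ ∧
      (D • V).a₆ = 9 * α₆ := by
  haveI : Finite (ResidueField ℤ_[3]) := Finite.of_equiv _ (PadicInt.residueField (p := 3)).toEquiv.symm
  have hirr : Irreducible (3 : ℤ_[3]) := by exact_mod_cast PadicInt.irreducible_p (p := 3)
  obtain ⟨D, h1, h2, h3, h4, h4', h6⟩ :=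
    Literature.NumberTheory.EllipticCurves.LocalIndex.exists_smul_of_kodairaSymbolOfMinimal_eq_III V hV
  obtain ⟨α₁, hα₁⟩ := (mem_maximalIdeal_iff_dvd_of_irreducible hirr _).mp h1
  obtain ⟨α₂, hα₂⟩ := (mem_maximalIdeal_iff_dvd_of_irreducible hirr _).mp h2
  obtain ⟨α₃, hα₃⟩ := (mem_maximalIdeal_iff_dvd_of_irreducible hirr _).mp h3
  obtain ⟨α₄, hα₄⟩ := (mem_maximalIdeal_iff_dvd_of_irreducible hirr _).mp h4
  obtain ⟨α₆, hα₆⟩ := (mem_maximalIdeal_pow_iff_dvd_of_irreducible hirr _ _).mp h6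
  have hα₄u : IsUnit α₄ := by
    by_contra hnu
    obtain ⟨β, hβ⟩ := padicInt_three_eq_three_mul_of_not_isUnit hnu
    exact h4' ((mem_maximalIdeal_pow_iff_dvd_of_irreducible hirr _ _).mpr ⟨β, by rw [hα₄, hβ]; ring⟩)
  refine ⟨D, α₁, α₂, α₃, α₄, α₆, hα₁, hα₂, hα₃, hα₄, hα₄u, ?_⟩
  rw [hα₆]; ring

/-! ### §3 Covariance of `Ψ₃` and `Ψ₂²` under a change of variables -/

section Field

variable {F : Type*} [Field F]

/-- Under `(x, y) ↦ (u²x + r, …)` the `3`-division polynomial `Ψ₃ = 3x⁴ + b₂x³ + 3b₄x² + 3b₆x + b₈` is covariant of weight `8`: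
`Ψ₃^{C • W}(u⁻²(x − r)) = u⁻⁸ Ψ₃^{W}(x)`. [folklore] -/
theorem threeDivision_eval_smul (W : WeierstrassCurve F) (C : VariableChange F) (x : F) :
    3 * ((C.u⁻¹ : Fˣ) ^ 2 * (x - C.r)) ^ 4 + (C • W).b₂ * ((C.u⁻¹ : Fˣ) ^ 2 * (x - C.r)) ^ 3 +
        3 * (C • W).b₄ * ((C.u⁻¹ : Fˣ) ^ 2 * (x - C.r)) ^ 2 + 3 * (C • W).b₆ * ((C.u⁻¹ : Fˣ) ^ 2 * (x - C.r)) +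
        (C • W).b₈ =
      ((C.u⁻¹ : Fˣ) : F) ^ 8 * (3 * x ^ 4 + W.b₂ * x ^ 3 + 3 * W.b₄ * x ^ 2 + 3 * W.b₆ * x + W.b₈) := by
  rw [variableChange_b₂, variableChange_b₄, variableChange_b₆, variableChange_b₈]
  push_cast
  ring

/-- Under `(x, y) ↦ (u²x + r, …)` the Kummer discriminant `Ψ₂² = 4x³ + b₂x² + 2b₄x + b₆` is covariant of weight `6`:
`Ψ₂²^{C • W}(u⁻²(x − r)) = u⁻⁶ Ψ₂²^{W}(x)`. [folklore] -/
theorem twoDivisionDisc_eval_smul (W : WeierstrassCurve F) (C : VariableChange F) (x : F) :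
    4 * ((C.u⁻¹ : Fˣ) ^ 2 * (x - C.r)) ^ 3 + (C • W).b₂ * ((C.u⁻¹ : Fˣ) ^ 2 * (x - C.r)) ^ 2 +
        2 * (C • W).b₄ * ((C.u⁻¹ : Fˣ) ^ 2 * (x - C.r)) + (C • W).b₆ =
      ((C.u⁻¹ : Fˣ) : F) ^ 6 * (4 * x ^ 3 + W.b₂ * x ^ 2 + 2 * W.b₄ * x + W.b₆) := by
  rw [variableChange_b₂, variableChange_b₄, variableChange_b₆]
  push_cast
  ring

end Field

/-! ### §4 The `b`-invariants of the normal form -/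

/-- On a `ℤ₃`-model `[3α₁, 3α₂, 3α₃, 3α₄, 9α₆]`: `b₂ = 3β`, `b₄ = 3γ`, `b₆ = 9δ`, `b₈ = 9(3ζ − α₄²)` with
`β = 3α₁² + 4α₂`, `γ = 2α₄ + 3α₁α₃`, `δ = α₃² + 4α₆`, `ζ = 3α₁²α₆ + 4α₂α₆ − α₁α₃α₄ + α₂α₃²` (read in `ℚ₃`). [folklore] -/
theorem map_b_of_IIINormalForm (M : WeierstrassCurve ℤ_[3]) {α₁ α₂ α₃ α₄ α₆ : ℤ_[3]} (h₁ : M.a₁ = 3 * α₁)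
    (h₂ : M.a₂ = 3 * α₂) (h₃ : M.a₃ = 3 * α₃) (h₄ : M.a₄ = 3 * α₄) (h₆ : M.a₆ = 9 * α₆) :
    (M.map PadicInt.Coe.ringHom).b₂ = 3 * ((3 * α₁ ^ 2 + 4 * α₂ : ℤ_[3]) : ℚ_[3]) ∧
      (M.map PadicInt.Coe.ringHom).b₄ = 3 * ((2 * α₄ + 3 * α₁ * α₃ : ℤ_[3]) : ℚ_[3]) ∧
      (M.map PadicInt.Coe.ringHom).b₆ = 9 * ((α₃ ^ 2 + 4 * α₆ : ℤ_[3]) : ℚ_[3]) ∧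
      (M.map PadicInt.Coe.ringHom).b₈ =
        9 * (3 * ((3 * α₁ ^ 2 * α₆ + 4 * α₂ * α₆ - α₁ * α₃ * α₄ + α₂ * α₃ ^ 2 : ℤ_[3]) : ℚ_[3]) - ((α₄ : ℤ_[3]) : ℚ_[3]) ^ 2) := by
  have e : ∀ z : ℤ_[3], (PadicInt.Coe.ringHom (p := 3)) z = (z : ℚ_[3]) := fun z => rfl
  have c2 : ((2 : ℤ_[3]) : ℚ_[3]) = 2 := by exact_mod_cast PadicInt.coe_natCast 2
  have c3 : ((3 : ℤ_[3]) : ℚ_[3]) = 3 := by exact_mod_cast PadicInt.coe_natCast 3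
  have c4 : ((4 : ℤ_[3]) : ℚ_[3]) = 4 := by exact_mod_cast PadicInt.coe_natCast 4
  have c9 : ((9 : ℤ_[3]) : ℚ_[3]) = 9 := by exact_mod_cast PadicInt.coe_natCast 9
  simp only [WeierstrassCurve.b₂, WeierstrassCurve.b₄, WeierstrassCurve.b₆, WeierstrassCurve.b₈, map_a₁, map_a₂, map_a₃,
    map_a₄, map_a₆, h₁, h₂, h₃, h₄, h₆, e]
  push_cast
  simp only [c2, c3, c4, c9]
  refine ⟨by ring, by ring, by ring, by ring⟩

end Summit.BirchSwinnertonDyer.BirchSwinnertonDyer.Theorems.ManinLocalTwoThree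

end
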